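import Literature.MathematicalPhysics.QuantumFieldTheory.Balaban1983to89.B8Prop7PrintedRZdGF3BoxFormInterTowerCStar
import Literature.MathematicalPhysics.QuantumFieldTheory.Balaban1983to89.Node00.Record12NumericsFamilyDict

/-!
# `Balaban1983to89.B8Prop7PrintedRZdGF3BoxFormInterTowerFamily` — the BOX-FORM typed-printed Proposition 7 faces AT THE FAMILY DICTIONARY `Node00.stage3OfFamily F`,
# RE-KEY-NEUTRAL (any coefficient algebra `(stage3OfFamily F).𝔸`)

EDITION CONTEXT (director-ym №260, FLAG №14 T0 (γ), 2026-08-29).  These four theorems are §4 of `B8Prop7PrintedRZdGF3BoxFormInterTower` (unit n05-w5 g3), MOVED here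
with the SAME short names and the SAME statements.  There they were proved off the `ℂ`-model certificate `…InterTower.not_prop7PrintedR_zdGF3_toAxialTower_boxForm F.L …`
read through `(stage3OfFamily F).𝔸 = ℂ` by `rfl`, which the RECORD-NONABELIAN re-key of the dictionary of record (`Node00.stage3OfRecord₁₂.𝔸 := Matrix (Fin 2) (Fin 2) ℂ`,
director-ym №256 (2)) removes; here they are ONE-LINE instances of the landed C⋆-GENERIC record faces of `B8Prop7PrintedRZdGF3BoxFormInterTowerCStar` §2 (n05-w
lineage: every record `θ : Node00.Stage3Params` with `θ.D = 4`, `θ.L ≥ 9`, ANY `θ.𝔸`) at `θ := stage3OfFamily F` (`D = 4` and `L = F.L` by `rfl`, `F.L ≥ 13` from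
`F.hL11`), so they elaborate today (`𝔸 = ℂ`) and after the re-key (`𝔸 = M₂(ℂ)`) alike.  The move could not be made inside `…InterTower` itself: its C⋆ twin imports it
(import cycle).

## WHAT IS PROVED (kernel, 0 sorry; theorems only)

For every `F : T4Family`, `β`, `len`, with `θ₀ := stage3OfFamily F`:
* ★ `exists_idxB8SubB_not_prop7PrintedR_boxForm_stage3OfFamily` — a lawful `k = 2`, admissible member `j : IdxB8SubB θ₀` at which `B8SectGH.Prop7PrintedR` of the one-member
  family `famB8OfRecordSubB θ₀ β len j` with print's pinned map `toAxialTowerResid θ₀ β len j.1` is FALSE;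
* ★★ `not_prop7PrintedR_famB8OfRecordSubB_toAxialTowerResid_stage3OfFamily`, ★★ `not_prop7PrintedR_famB8OfRecord_toAxialTowerResid_stage3OfFamily`,
  ★★ `not_prop7PrintedR_famB8OfRecordSubBH_toAxialTowerResid_stage3OfFamily` — the box-form `p7` binders of the SubB ∕ whole-family ∕ SubBH knits of record with the axial
  map PINNED to `toAxialTowerResid θ₀ …` are false.

## HONEST FRAMING

A NEGATIVE certificate about a proof CURRENCY (the typed-printed constant `2α₂` of [Balaban1985RegularSpaces] (1.145), box form, pinned map) — NO estimate of the paper is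
proved anew or denied; the REPAIRED currency (`B8Prop7TowerAxialRecord.prop7RepairedC_famB8OfRecordSubB(H)`, constant `530·D`) HOLDS on the same data and is untouched.
Bookkeeping only: four instantiations BY NAME.  Count-neutral helper keyed `stmt-QuantumFields-20541` (K0⁷, the re-key lane); N05 NOT discharged; no count claim; one finite
`𝕋⁴` programme at fixed `ε`, Bałaban AS PRINTED; the Yang–Mills mass gap (Clay) is NOT proved by any of this — nothing continuum ∕ ℝ⁴ ∕ OS.  No `sorry`, no `def`, no
`instance`, no `notation`.  Unit `pub-ymgap-node00-def-RR-2` (g20), 2026-08-29.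
-/

noncomputable section

namespace Literature.MathematicalPhysics.QuantumFieldTheory.Balaban1983to89.B8Prop7PrintedRZdGF3BoxFormInterTowerFamily

open B8IdxB8LawsB (IdxB8SubB famB8OfRecordSubB)
open B8ConstraintBonds (DomainSeq)
open Node00 (Stage3Params IdxB8 famB8OfRecord famB8OfRecordSubBH stage3OfFamily)
open B8Prop7TowerAxialRecord (toAxialTowerResid)
open B8Prop7PrintedRZdGF3BoxFormInterTowerCStar (exists_idxB8SubB_not_prop7PrintedR_boxForm not_prop7PrintedR_famB8OfRecordSubB_toAxialTowerResid
  not_prop7PrintedR_famB8OfRecord_toAxialTowerResid not_prop7PrintedR_famB8OfRecordSubBH_toAxialTowerResid)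
open T4Continuum (T4Family)

-- `Site` alone would resolve to the torus sites of `Setup.lean`; the `ℤ^d` sites are `B7Prop1Explicit.Site`.
variable (F : T4Family) (β : ℝ) (len : B7Prop1Explicit.Site (stage3OfFamily F).D → ℝ)

/-- `9 ≤ (stage3OfFamily F).L` (`= F.L` by `rfl`; print: «L an odd positive integer > 11»). [cite: Balaban1987RG1, (0.1) p.251 (bookkeeping)] -/
theorem nine_le_L_stage3OfFamily : 9 ≤ (stage3OfFamily F).L := by
  have := F.hL11
  show 9 ≤ F.L
  omega

/-- ★ **A LAWFUL `k = 2` MEMBER OF NODE 00's SUB-INDEX AT WHICH THE BOX-FORM TYPED-PRINTED PROPOSITION 7 ALREADY FAILS** (family dictionary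
`θ₀ := stage3OfFamily F`, any `β`, `len`, ANY `θ₀.𝔸`): `B8Prop7PrintedRZdGF3BoxFormInterTowerCStar.exists_idxB8SubB_not_prop7PrintedR_boxForm` at `θ₀` (`θ₀.D = 4` by `rfl`).
[cite: Balaban1985RegularSpaces, Prop. 7 (1.143)–(1.145) p.100, (1.66) p.88, (1.3)–(1.6) p.77, (1.131) p.99] -/
theorem exists_idxB8SubB_not_prop7PrintedR_boxForm_stage3OfFamily :
    ∃ j : IdxB8SubB (stage3OfFamily F), j.1.1.k = 2 ∧ DomainSeq F.L j.1.1.Ω ∧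
      ¬ B8SectGH.Prop7PrintedR (fun _ : Unit => famB8OfRecordSubB (stage3OfFamily F) β len j)
        (fun _ => toAxialTowerResid (stage3OfFamily F) β len j.1) :=
  exists_idxB8SubB_not_prop7PrintedR_boxForm (stage3OfFamily F) rfl (nine_le_L_stage3OfFamily F) β len

/-- ★★ **THE BOX-FORM `p7` BINDER OF THE K1 RECORD KNITS WITH THE AXIAL MAP PINNED IS FALSE AT THE FAMILY DICTIONARY** `θ₀ := stage3OfFamily F` (any `F`, `β`, `len`,
any `θ₀.𝔸`). [cite: Balaban1985RegularSpaces, Prop. 7 (1.143)–(1.145) p.100, (1.35) p.82, (1.66) p.88] -/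
theorem not_prop7PrintedR_famB8OfRecordSubB_toAxialTowerResid_stage3OfFamily :
    ¬ B8SectGH.Prop7PrintedR (fun j : IdxB8SubB (stage3OfFamily F) => famB8OfRecordSubB (stage3OfFamily F) β len j)
      (fun j => toAxialTowerResid (stage3OfFamily F) β len j.1) :=
  not_prop7PrintedR_famB8OfRecordSubB_toAxialTowerResid (stage3OfFamily F) rfl (nine_le_L_stage3OfFamily F) β len

/-- ★★ **… AND OVER THE WHOLE FAMILY OF RECORD** `famB8OfRecord θ₀ β len` with the pinned residual map `toAxialTowerResid θ₀ β len` itself, `θ₀ := stage3OfFamily F`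
(any `θ₀.𝔸`). [cite: Balaban1985RegularSpaces, Prop. 7 (1.143)–(1.145) p.100, (1.66) p.88] -/
theorem not_prop7PrintedR_famB8OfRecord_toAxialTowerResid_stage3OfFamily :
    ¬ B8SectGH.Prop7PrintedR (famB8OfRecord (stage3OfFamily F) β len) (toAxialTowerResid (stage3OfFamily F) β len) :=
  not_prop7PrintedR_famB8OfRecord_toAxialTowerResid (stage3OfFamily F) rfl (nine_le_L_stage3OfFamily F) β len

/-- ★★ **… AND AT THE REPAIRED-CARRIER TWIN `famB8OfRecordSubBH`**, `θ₀ := stage3OfFamily F` (any `θ₀.𝔸`).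
[cite: Balaban1985RegularSpaces, Prop. 7 (1.143)–(1.145) p.100, (1.66) p.88] -/
theorem not_prop7PrintedR_famB8OfRecordSubBH_toAxialTowerResid_stage3OfFamily :
    ¬ B8SectGH.Prop7PrintedR (fun j : IdxB8SubB (stage3OfFamily F) => famB8OfRecordSubBH (stage3OfFamily F) β len j)
      (fun j => toAxialTowerResid (stage3OfFamily F) β len j.1) :=
  not_prop7PrintedR_famB8OfRecordSubBH_toAxialTowerResid (stage3OfFamily F) rfl (nine_le_L_stage3OfFamily F) β len

end Literature.MathematicalPhysics.QuantumFieldTheory.Balaban1983to89.B8Prop7PrintedRZdGF3BoxFormInterTowerFamily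

end
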